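import Mathlib

/-!
# Crux `ExactCertificate` (stmt-AtomisticToContinuum-11959), line `closure-makes-nogap-exact`,
# Transfer skeleton V (`OneCrossingChainCertificate`): stub `stub_classTail`

Support file for the crux `ThreeConeCertificate.ExactCertificate`, d = 1 transfer skeleton V
(`Cruxes.ExactCertificate.Transfer1D.OneCrossingChainCertificate`).  This file proves the
registered stub `stub_classTail`, the class form of `stub_tailFzero` (file `…Transfer1DTail.lean`):
for an ABSTRACT pair potential `V : ℝ → ℝ` and a spacing `a > 0`, the tail interpolant

  `F_a(x) := Σ_{k ≥ 0} (k+1)·[V(|x+a| + (k+1)a) − 2·V(|x| + (k+1)a) + V(|x−a| + (k+1)a)]`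

(minus one quarter of the second difference of the retarded Green's function
`Ψ_a(x) = −4 Σ_{k ≥ 0} (k+1) V(|x| + (k+1)a)` of the discrete Laplacian `Δ_a`) satisfies the two
TELESCOPING identities

* (i)  `F_a(x) = V(x)` for every `x ≥ a`: all absolute values open up, the `k`-th term is
  `(k+1)(u_{k+2} − 2u_{k+1} + u_k)` with `u_m := V(x + m a)`, the partial sums are
  `K·u_{K+1} − (K+1)·u_K + u_0`, and both boundary terms tend to `0`;
* (ii) `F_a(0) = −2 Σ_{m ≥ 1} V(m a)`: with `u_m := V(m a)` the `k`-th term is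
  `2(k+1)(u_{k+2} − u_{k+1})`, the partial sums are `2K·u_{K+1} − 2 Σ_{m=1}^{K} u_m`,

GIVEN only the two summability hypotheses `Σ_k (k+1) V(y + (k+1)a)` and `Σ_k V(y + (k+1)a)`
(`y ≥ 0`), whose terms therefore tend to `0`.  Pure series bookkeeping (`HasSum.tendsto_sum_nat`,
`tendsto_nhds_unique`, `Summable.tendsto_atTop_zero`); helper lemmas prefixed `classTail_`.
All `[folklore]`; no named facts are used.
-/

noncomputable section

namespace Summit.AtomisticToContinuum.Crystallization.Theorems.ThreeConeCertificateExactCertificate.Transfer1D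

open MeasureTheory Set Filter Topology
open scoped BigOperators

/-- (i) The tail interpolant pays the far field exactly: for `a > 0`, `x ≥ a` and `V` with
`Σ_k (k+1) V(y + (k+1)a)` summable for every `y ≥ 0`,
`Σ_k (k+1)[V(|x+a|+(k+1)a) − 2V(|x|+(k+1)a) + V(|x−a|+(k+1)a)] = V(x)` (partial sums
`K·V(x+(K+1)a) − (K+1)·V(x+Ka) + V(x)`, boundary terms `→ 0`). [folklore] -/
theorem classTail_tail_eq {V : ℝ → ℝ} {a x : ℝ} (ha : 0 < a)
    (hS1 : ∀ y : ℝ, 0 ≤ y → Summable (fun k : ℕ => ((k : ℝ) + 1) * V (y + ((k : ℝ) + 1) * a)))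
    (hx : a ≤ x) :
    ∑' k : ℕ, ((k : ℝ) + 1) * (V (|x + a| + ((k : ℝ) + 1) * a)
      - 2 * V (|x| + ((k : ℝ) + 1) * a) + V (|x - a| + ((k : ℝ) + 1) * a)) = V x := by
  have hx0 : 0 < x := ha.trans_le hx
  rw [abs_of_pos (by linarith : 0 < x + a), abs_of_pos hx0, abs_of_nonneg (by linarith : 0 ≤ x - a)]
  -- closed form of the partial sums
  have hpartial : ∀ K : ℕ, ∑ k ∈ Finset.range K, ((k : ℝ) + 1) *
      (V (x + a + ((k : ℝ) + 1) * a) - 2 * V (x + ((k : ℝ) + 1) * a)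
        + V (x - a + ((k : ℝ) + 1) * a)) =
      (K : ℝ) * V (x + ((K : ℝ) + 1) * a) - ((K : ℝ) + 1) * V (x + (K : ℝ) * a) + V x := by
    intro K
    induction K with
    | zero => simp
    | succ K ih =>
      rw [Finset.sum_range_succ, ih]
      push_cast
      rw [show x + a + ((K : ℝ) + 1) * a = x + ((K : ℝ) + 1 + 1) * a by ring,
        show x - a + ((K : ℝ) + 1) * a = x + (K : ℝ) * a by ring]
      ring
  -- summability of the series
  have hsum : Summable (fun k : ℕ => ((k : ℝ) + 1) *
      (V (x + a + ((k : ℝ) + 1) * a) - 2 * V (x + ((k : ℝ) + 1) * a)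
        + V (x - a + ((k : ℝ) + 1) * a))) := by
    have h1 := hS1 (x + a) (by linarith)
    have h2 := hS1 x (by linarith)
    have h3 := hS1 (x - a) (by linarith)
    refine ((h1.sub (h2.mul_left 2)).add h3).congr fun k => ?_
    ring
  -- the two boundary terms tend to zero
  have hA : Tendsto (fun K : ℕ => (K : ℝ) * V (x + ((K : ℝ) + 1) * a)) atTop (𝓝 0) := by
    rw [← tendsto_add_atTop_iff_nat 1]
    refine (hS1 (x + a) (by linarith)).tendsto_atTop_zero.congr fun K => ?_
    push_cast
    rw [show x + a + ((K : ℝ) + 1) * a = x + ((K : ℝ) + 1 + 1) * a by ring]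
  have hB : Tendsto (fun K : ℕ => ((K : ℝ) + 1) * V (x + (K : ℝ) * a)) atTop (𝓝 0) := by
    refine (hS1 (x - a) (by linarith)).tendsto_atTop_zero.congr fun K => ?_
    rw [show x - a + ((K : ℝ) + 1) * a = x + (K : ℝ) * a by ring]
  have hlim := ((hA.sub hB).add_const (V x)).congr fun K => (hpartial K).symm
  rw [tendsto_nhds_unique hsum.hasSum.tendsto_sum_nat hlim]
  ring

/-- (ii) The value at the origin: for `a > 0` and `V` with `Σ_k (k+1) V(y + (k+1)a)` and
`Σ_k V(y + (k+1)a)` summable for every `y ≥ 0`,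
`Σ_k (k+1)[V(a+(k+1)a) − 2V((k+1)a) + V(a+(k+1)a)] = −2 Σ_k V((k+1)a)` (partial sums
`2K·V((K+1)a) − 2 Σ_{k<K} V((k+1)a)`). [folklore] -/
theorem classTail_zero_eq {V : ℝ → ℝ} {a : ℝ} (ha : 0 < a)
    (hS1 : ∀ y : ℝ, 0 ≤ y → Summable (fun k : ℕ => ((k : ℝ) + 1) * V (y + ((k : ℝ) + 1) * a)))
    (hS0 : ∀ y : ℝ, 0 ≤ y → Summable (fun k : ℕ => V (y + ((k : ℝ) + 1) * a))) :
    ∑' k : ℕ, ((k : ℝ) + 1) * (V (a + ((k : ℝ) + 1) * a) - 2 * V (((k : ℝ) + 1) * a)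
      + V (a + ((k : ℝ) + 1) * a)) = -2 * ∑' k : ℕ, V (((k : ℝ) + 1) * a) := by
  -- closed form of the partial sums
  have hpartial : ∀ K : ℕ, ∑ k ∈ Finset.range K, ((k : ℝ) + 1) *
      (V (a + ((k : ℝ) + 1) * a) - 2 * V (((k : ℝ) + 1) * a) + V (a + ((k : ℝ) + 1) * a)) =
      2 * ((K : ℝ) * V (a + (K : ℝ) * a))
        - 2 * ∑ k ∈ Finset.range K, V (((k : ℝ) + 1) * a) := by
    intro K
    induction K with
    | zero => simp
    | succ K ih =>
      rw [Finset.sum_range_succ, Finset.sum_range_succ, ih]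
      push_cast
      rw [show a + (K : ℝ) * a = ((K : ℝ) + 1) * a by ring]
      ring
  -- summability of the series
  have hsum : Summable (fun k : ℕ => ((k : ℝ) + 1) *
      (V (a + ((k : ℝ) + 1) * a) - 2 * V (((k : ℝ) + 1) * a) + V (a + ((k : ℝ) + 1) * a))) := by
    have h1 := hS1 a ha.le
    have h2 : Summable (fun k : ℕ => ((k : ℝ) + 1) * V (((k : ℝ) + 1) * a)) :=
      (hS1 0 le_rfl).congr fun k => by rw [zero_add]
    refine ((h1.sub (h2.mul_left 2)).add h1).congr fun k => ?_
    ring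
  -- the boundary term tends to zero, the chain sum converges
  have hA : Tendsto (fun K : ℕ => (K : ℝ) * V (a + (K : ℝ) * a)) atTop (𝓝 0) := by
    rw [← tendsto_add_atTop_iff_nat 1]
    refine (hS1 a ha.le).tendsto_atTop_zero.congr fun K => ?_
    push_cast
    ring
  have hS : Tendsto (fun K : ℕ => ∑ k ∈ Finset.range K, V (((k : ℝ) + 1) * a)) atTop
      (𝓝 (∑' k : ℕ, V (((k : ℝ) + 1) * a))) :=
    ((hS0 0 le_rfl).congr fun k => by rw [zero_add]).hasSum.tendsto_sum_nat
  have hlim := ((hA.const_mul 2).sub (hS.const_mul 2)).congr fun K => (hpartial K).symm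
  rw [tendsto_nhds_unique hsum.hasSum.tendsto_sum_nat hlim]
  ring

/-- **Registered stub `stub_classTail`** (telescoping identities of the retarded Green's function of
`Δ_a`, class form of `stub_tailFzero`): for every `V : ℝ → ℝ` and `a > 0` such that
`Σ_k (k+1) V(y + (k+1)a)` and `Σ_k V(y + (k+1)a)` are summable for every `y ≥ 0`,
(i) `F_a = V` on `[a, ∞)` and (ii) `F_a(0) = −2 Σ_{m ≥ 1} V(m a)`, where
`F_a(x) = Σ_{k ≥ 0} (k+1)[V(|x+a|+(k+1)a) − 2V(|x|+(k+1)a) + V(|x−a|+(k+1)a)]`. [folklore] -/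
theorem stub_classTail : ∀ (V : ℝ → ℝ) (a : ℝ), 0 < a →
    (∀ y : ℝ, 0 ≤ y → Summable (fun k : ℕ => ((k : ℝ) + 1) * V (y + ((k : ℝ) + 1) * a))) →
    (∀ y : ℝ, 0 ≤ y → Summable (fun k : ℕ => V (y + ((k : ℝ) + 1) * a))) →
    (∀ x : ℝ, a ≤ x → ∑' k : ℕ, ((k : ℝ) + 1) * (V (|x + a| + ((k : ℝ) + 1) * a)
      - 2 * V (|x| + ((k : ℝ) + 1) * a) + V (|x - a| + ((k : ℝ) + 1) * a)) = V x) ∧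
    (∑' k : ℕ, ((k : ℝ) + 1) * (V (a + ((k : ℝ) + 1) * a) - 2 * V (((k : ℝ) + 1) * a)
      + V (a + ((k : ℝ) + 1) * a)) = -2 * ∑' k : ℕ, V (((k : ℝ) + 1) * a)) := by
  intro V a ha hS1 hS0
  exact ⟨fun _ hx => classTail_tail_eq ha hS1 hx, classTail_zero_eq ha hS1 hS0⟩

end Summit.AtomisticToContinuum.Crystallization.Theorems.ThreeConeCertificateExactCertificate.Transfer1D

end
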